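import Mathlib
import Literature.MathematicalPhysics.StatisticalMechanics.BarlowStackingEnergy
import Summits.AtomisticToContinuum.Crystallization.Theorems.MinMeanCycleStackingLockLockedBoxMinimiserLayerSums
import Summits.AtomisticToContinuum.Crystallization.Theorems.SquareWellLayerCakeStackingFaultSparsityOffBoxDefs

/-!
# `StackingFaultSparsity` (stmt-AtomisticToContinuum-14296), line `Sketch`: the off-box reduction
(stub `stub_offBoxReduction`)

The word-free lower bound of the energy per particle of a Barlow stacking with in-layer spacing `a`
and layer spacing `h` is

  `W(a, h) = barlowBaseEnergy V a h - ∑_{k ≥ 2} |barlowCoupling V a h k|`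
          `= ½ Φ_in + ∑_{k ≥ 1} Φ_N(k) - ∑_{k ≥ 2} |Φ_A(k) - Φ_N(k)|`

(`V = lennardJones`, `Φ_N(k) = layerInteraction V a h 1 k`, `Φ_A(k) = layerInteraction V a h 0 k`,
`Φ_in = inLayerInteraction V a`).  Given

* the identities of the line (hypothesis 1, stub `stub_offBoxIdentities`): with `α = (a¹²)⁻¹/12`,
  `β = (a⁶)⁻¹/6`, `c = h/a`, `Φ_in = α T₆ - β T₃`, `Φ_N(k) = α N₆(k) - β N₃(k)`,
  `Φ_A(k) = α A₆(k) - β A₃(k)` where `T_e = layerSum e c 0`, `N_e(k) = layerSum e (k c) 1`,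
  `A_e(k) = layerSum e (k c / 2) 2` are layers of the certified hcp lattice sums of
  `…CoarseGrainsPinSums` (`…OffBoxDefs`);
* the layer certification (hypothesis 2, stub `stub_offBoxLayerCert`; not needed here beyond the
  non-negativity of the layer sums, which holds termwise);
* the far-layer tails (hypothesis 3, stub `stub_offBoxFarLayers`):
  `∑_{K < k ≤ K+n} N₃(k), ∑ A₃(k) ≤ farTail3 K c`, `∑ A₆(k) ≤ farTail6 K c` uniformly in `n`,

this file proves the bookkeeping inequality

  `α · offBoxA 12 c - β · offBoxB 12 c ≤ W(a, h)`:

per layer `Φ_N - |Φ_A - Φ_N| = min (Φ_A, 2 Φ_N - Φ_A) ≥ α min (A₆, 2N₆ - A₆) - β max (A₃, 2N₃ - A₃)`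
for the certified layers `2 ≤ k ≤ 12`, `≥ -(α A₆ + β (A₃ + 2 N₃))` for `k ≥ 13` (all layer sums are
`≥ 0`), the two series are split at the twelfth layer (`Summable.sum_add_tsum_nat_add`; summability
from `LockedBoxMinimiser.exists_bound_layerInteraction`) and the far part is bounded through its
partial sums (`ge_of_tendsto'`).  Elementary real analysis, `[folklore]`.
-/

noncomputable section

namespace Summit.AtomisticToContinuum.Crystallization.Theorems.SquareWellLayerCake.StackingFaultSparsity

open Literature.MathematicalPhysics.StatisticalMechanics
open Summit.AtomisticToContinuum.Crystallization.Theorems.ExcessDecayLiouvilleCoarseGrains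
open Finset Filter Topology

/-! ## Elementary helpers -/

/-- Layer sums are non-negative (every `hcpSumTerm` is). [folklore] -/
theorem offBoxReduction_layerSum_nonneg (e : ℕ) (c : ℝ) (k : ℤ) : 0 ≤ layerSum e c k :=
  tsum_nonneg fun ij => hcpSumTerm_nonneg e c (k, ij.1, ij.2)

/-- The Lennard-Jones layer interactions `k ↦ Φ_δ(k)` are summable over the layer index `k : ℕ`
(`a, h > 0`; uniform majorant of `LockedBoxMinimiser.exists_bound_layerInteraction`). [folklore] -/
theorem offBoxReduction_summable_layerInteraction {a h : ℝ} (ha : 0 < a) (hh : 0 < h) (δ : ℤ) :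
    Summable fun k : ℕ => layerInteraction lennardJones a h δ (k : ℤ) := by
  obtain ⟨u, hu, hb⟩ := LockedBoxMinimiser.exists_bound_layerInteraction ha hh δ
  have hinj : Function.Injective fun k : ℕ => ((k + 1 : ℕ) : ℤ) := by
    intro m n hmn
    have h' : ((m + 1 : ℕ) : ℤ) = ((n + 1 : ℕ) : ℤ) := hmn
    omega
  have hs : Summable fun k : ℕ => u ((k + 1 : ℕ) : ℤ) :=
    (hu.comp_injective hinj).congr fun _ => rfl
  have h1 : Summable fun k : ℕ => layerInteraction lennardJones a h δ ((k + 1 : ℕ) : ℤ) := by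
    refine Summable.of_norm_bounded hs fun k => ?_
    rw [Real.norm_eq_abs]
    exact hb _ (by exact_mod_cast Nat.succ_ne_zero k) (a, h) ⟨Set.self_mem_Ici, Set.self_mem_Ici⟩
  exact (summable_nat_add_iff (f := fun k : ℕ => layerInteraction lennardJones a h δ (k : ℤ)) 1).mp
    h1

/-- Reindexing `∑_{K < m ≤ K + n} F m = ∑_{i < n} F (i + K + 1)`. [folklore] -/
theorem offBoxReduction_sum_Ioc_eq_sum_range (F : ℕ → ℝ) (K : ℕ) :
    ∀ n : ℕ, ∑ m ∈ Ioc K (K + n), F m = ∑ i ∈ range n, F (i + K + 1)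
  | 0 => by simp
  | n + 1 => by
      rw [← add_assoc, sum_Ioc_succ_top (Nat.le_add_right K n),
        offBoxReduction_sum_Ioc_eq_sum_range F K n, sum_range_succ, Nat.add_comm n K]

/-- Reindexing `∑_{2 ≤ m ≤ n + 1} F m = ∑_{i < n} F (i + 2)`. [folklore] -/
theorem offBoxReduction_sum_Icc_eq_sum_range (F : ℕ → ℝ) :
    ∀ n : ℕ, ∑ m ∈ Icc 2 (n + 1), F m = ∑ i ∈ range n, F (i + 2)
  | 0 => by simp
  | n + 1 => by
      rw [sum_Icc_succ_top (by omega : 2 ≤ n + 1 + 1), offBoxReduction_sum_Icc_eq_sum_range F n,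
        sum_range_succ]

/-- **Per-layer bound, certified layers**: with `Φ_N = α N₆ - β N₃`, `Φ_A = α A₆ - β A₃` and
`α, β ≥ 0`, `Φ_N - |Φ_A - Φ_N| = min (Φ_A, 2Φ_N - Φ_A) ≥ α min (A₆, 2N₆ - A₆) - β max (A₃, 2N₃ - A₃)`.
[folklore] -/
theorem offBoxReduction_layer_min_bound {α β A6 A3 N6 N3 : ℝ} (hα : 0 ≤ α) (hβ : 0 ≤ β) :
    α * min A6 (2 * N6 - A6) - β * max A3 (2 * N3 - A3) ≤
      (α * N6 - β * N3) - |(α * A6 - β * A3) - (α * N6 - β * N3)| := by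
  have h1 : α * min A6 (2 * N6 - A6) ≤ α * A6 := mul_le_mul_of_nonneg_left (min_le_left _ _) hα
  have h2 : α * min A6 (2 * N6 - A6) ≤ α * (2 * N6 - A6) :=
    mul_le_mul_of_nonneg_left (min_le_right _ _) hα
  have h3 : β * A3 ≤ β * max A3 (2 * N3 - A3) := mul_le_mul_of_nonneg_left (le_max_left _ _) hβ
  have h4 : β * (2 * N3 - A3) ≤ β * max A3 (2 * N3 - A3) :=
    mul_le_mul_of_nonneg_left (le_max_right _ _) hβ
  rcases le_or_gt 0 ((α * A6 - β * A3) - (α * N6 - β * N3)) with h | h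
  · rw [abs_of_nonneg h]
    linarith
  · rw [abs_of_neg h]
    linarith

/-- **Per-layer bound, far layers**: with non-negative layer sums and `α, β ≥ 0`,
`Φ_N - |Φ_A - Φ_N| ≥ -(α A₆ + β (A₃ + 2 N₃))`. [folklore] -/
theorem offBoxReduction_layer_far_bound {α β A6 A3 N6 N3 : ℝ} (hα : 0 ≤ α) (hβ : 0 ≤ β)
    (hA6 : 0 ≤ A6) (hA3 : 0 ≤ A3) (hN6 : 0 ≤ N6) (hN3 : 0 ≤ N3) :
    -(α * A6 + β * (A3 + 2 * N3)) ≤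
      (α * N6 - β * N3) - |(α * A6 - β * A3) - (α * N6 - β * N3)| := by
  have h1 := mul_nonneg hα hA6
  have h2 := mul_nonneg hβ hA3
  have h3 := mul_nonneg hα hN6
  have h4 := mul_nonneg hβ hN3
  rcases le_or_gt 0 ((α * A6 - β * A3) - (α * N6 - β * N3)) with h | h
  · rw [abs_of_nonneg h]
    linarith
  · rw [abs_of_neg h]
    linarith

/-! ## The abstract bookkeeping -/

/-- **The bookkeeping behind the off-box reduction**, for abstract sequences: if `N, A : ℕ → ℝ` are
summable, `N k = α N₆ k - β N₃ k` and `A k = α A₆ k - β A₃ k` for `k ≠ 0` with non-negative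
`N₆, N₃, A₆, A₃` and `α, β ≥ 0`, and the far partial sums `∑_{12 < k ≤ 12+n}` of `A₆` (resp. `A₃`,
`N₃`) are bounded by `F₆` (resp. `F₃`), then
`α (N₆ 1 + ∑_{k=2}^{12} min (A₆ k, 2N₆ k - A₆ k) - F₆) - β (N₃ 1 + ∑_{k=2}^{12} max (A₃ k, 2N₃ k - A₃ k) + 3F₃)`
`≤ ∑_{k ≥ 1} N k - ∑_{k ≥ 2} |A k - N k|`. [folklore] -/
theorem offBoxReduction_bookkeeping {N A N6 N3 A6 A3 : ℕ → ℝ} {α β F6 F3 : ℝ}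
    (hNs : Summable N) (hAs : Summable A) (hα : 0 ≤ α) (hβ : 0 ≤ β)
    (hN : ∀ k : ℕ, k ≠ 0 → N k = α * N6 k - β * N3 k)
    (hA : ∀ k : ℕ, k ≠ 0 → A k = α * A6 k - β * A3 k)
    (hN6 : ∀ k, 0 ≤ N6 k) (hN3 : ∀ k, 0 ≤ N3 k) (hA6 : ∀ k, 0 ≤ A6 k) (hA3 : ∀ k, 0 ≤ A3 k)
    (hF6 : ∀ n : ℕ, ∑ k ∈ Ioc 12 (12 + n), A6 k ≤ F6)
    (hF3A : ∀ n : ℕ, ∑ k ∈ Ioc 12 (12 + n), A3 k ≤ F3)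
    (hF3N : ∀ n : ℕ, ∑ k ∈ Ioc 12 (12 + n), N3 k ≤ F3) :
    α * (N6 1 + ∑ k ∈ Icc 2 12, min (A6 k) (2 * N6 k - A6 k) - F6) -
        β * (N3 1 + ∑ k ∈ Icc 2 12, max (A3 k) (2 * N3 k - A3 k) + 3 * F3) ≤
      ∑' k, N (k + 1) - ∑' k, |A (k + 2) - N (k + 2)| := by
  -- (1) summability of the shifted families
  have hNs1 : Summable fun k => N (k + 1) := (summable_nat_add_iff 1).mpr hNs
  have hNs2 : Summable fun k => N (k + 2) := (summable_nat_add_iff 2).mpr hNs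
  have hAs2 : Summable fun k => A (k + 2) := (summable_nat_add_iff 2).mpr hAs
  have habs : Summable fun k => |A (k + 2) - N (k + 2)| := (hAs2.sub hNs2).abs
  have hg : Summable fun k => N (k + 2) - |A (k + 2) - N (k + 2)| := hNs2.sub habs
  have hNs13 : Summable fun k => N (k + 13) := (summable_nat_add_iff 13).mpr hNs
  have hAs13 : Summable fun k => A (k + 13) := (summable_nat_add_iff 13).mpr hAs
  have hg13 : Summable fun k => N (k + 13) - |A (k + 13) - N (k + 13)| :=
    hNs13.sub (hAs13.sub hNs13).abs
  -- (2) splitting the series at the first and at the twelfth layer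
  have e1 : ∑' k, N (k + 1) = N 1 + ∑' k, N (k + 2) := by
    rw [hNs1.tsum_eq_zero_add]
  have e2 : ∑' k, (N (k + 2) - |A (k + 2) - N (k + 2)|) =
      ∑' k, N (k + 2) - ∑' k, |A (k + 2) - N (k + 2)| := hNs2.tsum_sub habs
  have e3 : ∑' k, (N (k + 2) - |A (k + 2) - N (k + 2)|) =
      ∑ k ∈ range 11, (N (k + 2) - |A (k + 2) - N (k + 2)|) +
        ∑' k, (N (k + 13) - |A (k + 13) - N (k + 13)|) := by
    rw [← hg.sum_add_tsum_nat_add 11]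
  -- (3) the certified layers `2, …, 12`
  have hfin : α * ∑ k ∈ range 11, min (A6 (k + 2)) (2 * N6 (k + 2) - A6 (k + 2)) -
      β * ∑ k ∈ range 11, max (A3 (k + 2)) (2 * N3 (k + 2) - A3 (k + 2)) ≤
      ∑ k ∈ range 11, (N (k + 2) - |A (k + 2) - N (k + 2)|) := by
    rw [mul_sum, mul_sum, ← sum_sub_distrib]
    refine sum_le_sum fun k _ => ?_
    rw [hN (k + 2) (by omega), hA (k + 2) (by omega)]
    exact offBoxReduction_layer_min_bound hα hβ
  have eI6 : ∑ k ∈ Icc 2 12, min (A6 k) (2 * N6 k - A6 k) =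
      ∑ k ∈ range 11, min (A6 (k + 2)) (2 * N6 (k + 2) - A6 (k + 2)) :=
    offBoxReduction_sum_Icc_eq_sum_range _ 11
  have eI3 : ∑ k ∈ Icc 2 12, max (A3 k) (2 * N3 k - A3 k) =
      ∑ k ∈ range 11, max (A3 (k + 2)) (2 * N3 (k + 2) - A3 (k + 2)) :=
    offBoxReduction_sum_Icc_eq_sum_range _ 11
  -- (4) the far layers `k ≥ 13`, through the partial sums
  have hfar : -(α * F6 + β * (F3 + 2 * F3)) ≤
      ∑' k, (N (k + 13) - |A (k + 13) - N (k + 13)|) := by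
    refine ge_of_tendsto' hg13.hasSum.tendsto_sum_nat fun n => ?_
    show -(α * F6 + β * (F3 + 2 * F3)) ≤
      ∑ i ∈ range n, (N (i + 13) - |A (i + 13) - N (i + 13)|)
    have hpt : ∑ i ∈ range n, -(α * A6 (i + 13) + β * (A3 (i + 13) + 2 * N3 (i + 13))) ≤
        ∑ i ∈ range n, (N (i + 13) - |A (i + 13) - N (i + 13)|) := by
      refine sum_le_sum fun i _ => ?_
      rw [hN (i + 13) (by omega), hA (i + 13) (by omega)]
      exact offBoxReduction_layer_far_bound hα hβ (hA6 _) (hA3 _) (hN6 _) (hN3 _)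
    simp only [sum_neg_distrib, sum_add_distrib, ← mul_sum] at hpt
    have h6 : α * ∑ i ∈ range n, A6 (i + 13) ≤ α * F6 := by
      refine mul_le_mul_of_nonneg_left ?_ hα
      have := hF6 n
      rwa [offBoxReduction_sum_Ioc_eq_sum_range A6 12 n] at this
    have h3a : β * ∑ i ∈ range n, A3 (i + 13) ≤ β * F3 := by
      refine mul_le_mul_of_nonneg_left ?_ hβ
      have := hF3A n
      rwa [offBoxReduction_sum_Ioc_eq_sum_range A3 12 n] at this
    have h3n : β * ∑ i ∈ range n, N3 (i + 13) ≤ β * F3 := by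
      refine mul_le_mul_of_nonneg_left ?_ hβ
      have := hF3N n
      rwa [offBoxReduction_sum_Ioc_eq_sum_range N3 12 n] at this
    linarith
  -- (5) assembling
  rw [eI6, eI3]
  have hN1 := hN 1 one_ne_zero
  linarith

/-! ## The stub -/

/-- **Stub `stub_offBoxReduction`** of line `Sketch` of `StackingFaultSparsity`: given the layer
identities, the layer certification and the far-layer tails,
`(a¹²)⁻¹/12 · offBoxA 12 (h/a) - (a⁶)⁻¹/6 · offBoxB 12 (h/a) ≤ barlowBaseEnergy V a h - ∑_{k ≥ 2} |barlowCoupling V a h k|`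
for `V = lennardJones` and all `a, h > 0`. [folklore] -/
theorem stub_offBoxReduction :
    (∀ (a h : ℝ), 0 < a → 0 < h →
      inLayerInteraction lennardJones a =
          1 / 12 * (a ^ 12)⁻¹ * layerSum 6 (h / a) 0 - 1 / 6 * (a ^ 6)⁻¹ * layerSum 3 (h / a) 0 ∧
      (∀ k : ℕ, k ≠ 0 →
        layerInteraction lennardJones a h 1 (k : ℤ) =
          1 / 12 * (a ^ 12)⁻¹ * layerSum 6 ((k : ℝ) * (h / a)) 1 -
            1 / 6 * (a ^ 6)⁻¹ * layerSum 3 ((k : ℝ) * (h / a)) 1) ∧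
      (∀ k : ℕ, k ≠ 0 →
        layerInteraction lennardJones a h 0 (k : ℤ) =
          1 / 12 * (a ^ 12)⁻¹ * layerSum 6 ((k : ℝ) * (h / a) / 2) 2 -
            1 / 6 * (a ^ 6)⁻¹ * layerSum 3 ((k : ℝ) * (h / a) / 2) 2)) →
    (∀ (e : ℕ), 3 ≤ e → ∀ (c : ℝ), 0 < c → ∀ (k : ℤ),
      Summable (fun ij : ℤ × ℤ => hcpSumTerm e c (k, ij.1, ij.2)) ∧
      (∀ K : ℕ, 1 ≤ K →
        ∑ ij ∈ layerSquare K, hcpSumTerm e c (k, ij.1, ij.2) ≤ layerSum e c k ∧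
        layerSum e c k ≤ ∑ ij ∈ layerSquare K, hcpSumTerm e c (k, ij.1, ij.2) + layerTail e K ((k : ℝ) * c)) ∧
      (∀ c' : ℝ, c ≤ c' → layerSum e c' k ≤ layerSum e c k)) →
    (∀ (c : ℝ), 0 < c → ∀ (K : ℕ), 1 ≤ K → ∀ n : ℕ,
      ∑ k ∈ Finset.Ioc K (K + n), layerSum 3 ((k : ℝ) * c) 1 ≤ farTail3 K c ∧
      ∑ k ∈ Finset.Ioc K (K + n), layerSum 3 ((k : ℝ) * c / 2) 2 ≤ farTail3 K c ∧
      ∑ k ∈ Finset.Ioc K (K + n), layerSum 6 ((k : ℝ) * c / 2) 2 ≤ farTail6 K c) →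
    ∀ (a h : ℝ), 0 < a → 0 < h →
      1 / 12 * (a ^ 12)⁻¹ * offBoxA 12 (h / a) - 1 / 6 * (a ^ 6)⁻¹ * offBoxB 12 (h / a) ≤
        barlowBaseEnergy lennardJones a h - ∑' k : ℕ, |barlowCoupling lennardJones a h (k + 2)| := by
  intro hId _hCert hFar a h ha hh
  obtain ⟨hIn, hN, hA⟩ := hId a h ha hh
  have hc : 0 < h / a := div_pos hh ha
  have hα : (0 : ℝ) ≤ 1 / 12 * (a ^ 12)⁻¹ := by positivity
  have hβ : (0 : ℝ) ≤ 1 / 6 * (a ^ 6)⁻¹ := by positivity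
  have key := offBoxReduction_bookkeeping
    (N := fun m : ℕ => layerInteraction lennardJones a h 1 (m : ℤ))
    (A := fun m : ℕ => layerInteraction lennardJones a h 0 (m : ℤ))
    (N6 := fun m : ℕ => layerSum 6 ((m : ℝ) * (h / a)) 1)
    (N3 := fun m : ℕ => layerSum 3 ((m : ℝ) * (h / a)) 1)
    (A6 := fun m : ℕ => layerSum 6 ((m : ℝ) * (h / a) / 2) 2)
    (A3 := fun m : ℕ => layerSum 3 ((m : ℝ) * (h / a) / 2) 2)
    (α := 1 / 12 * (a ^ 12)⁻¹) (β := 1 / 6 * (a ^ 6)⁻¹)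
    (F6 := farTail6 12 (h / a)) (F3 := farTail3 12 (h / a))
    (offBoxReduction_summable_layerInteraction ha hh 1)
    (offBoxReduction_summable_layerInteraction ha hh 0) hα hβ hN hA
    (fun _ => offBoxReduction_layerSum_nonneg _ _ _) (fun _ => offBoxReduction_layerSum_nonneg _ _ _)
    (fun _ => offBoxReduction_layerSum_nonneg _ _ _) (fun _ => offBoxReduction_layerSum_nonneg _ _ _)
    (fun n => (hFar _ hc 12 (by norm_num) n).2.2) (fun n => (hFar _ hc 12 (by norm_num) n).2.1)
    (fun n => (hFar _ hc 12 (by norm_num) n).1)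
  unfold barlowBaseEnergy barlowCoupling
  rw [hIn]
  simp only [offBoxA, offBoxB, Nat.cast_one, one_mul] at key ⊢
  linarith

end Summit.AtomisticToContinuum.Crystallization.Theorems.SquareWellLayerCake.StackingFaultSparsity

end
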